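import Summits.BirchSwinnertonDyer.BirchSwinnertonDyer.Theorems.EisensteinPrimesGoodLatticeThmII64PeriodAxis
import Summits.BirchSwinnertonDyer.Rank1Residual.X11b.HalvesReceptacle
import Summits.BirchSwinnertonDyer.BirchSwinnertonDyer.Theorems.EisensteinPrimesGoodLatticeBDPValueOfNamedFactsV34
import HarnessLib

set_option linter.dupNamespace false
set_option autoImplicit false

/-!
# `DeShalit1987.thmII64_katzMeasure₂_functionalEquation` FROM ITS ∃-SHAPED (PRINT-SHAPED) FORM — the «∀ ⟸ ∃» certificate for the
# seventh PUBLISHED by-name input of crux 2 `GoodLatticeBDPValue` (stmt-BirchSwinnertonDyer-19032)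

Cell `bsd-eis`, width seat `bsd-line-x1-p1-w2` gen 32; `--supports stmt-BirchSwinnertonDyer-19032` (crux 2, line `halves` v34N; helper, closes
nothing).  File 8 (capstone) of the thmII64 certificates: `…KatzMeasureUniqueness` (p769753), `…UniquenessBinders` (p770237),
`…PeriodRigidityAnyType` (p770888), `…RigidityUnitValues`, `…ReflectTransport`, `…ReflectFrame`, `…ThmII64PeriodAxis`.
THEOREMS ONLY (no `def`, no named fact, no `sorry`).

THE POINT.  The Literature named fact `DeShalit1987.thmII64_katzMeasure₂_functionalEquation` (de Shalit 1987, II.6.4 Theorem (i) in measure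
form (14)–(15), = Bleher et al. 2020 Lemma 3.3.2) is typed as a ∀-FRAME statement — «for ANY `G` with `IsKatzMeasure₂ … λ … G` there are
`Ǧ, C, g` with `G(P r) = C·r(g)·Ǧ(P r₂)`» — universally over period triples `(Ω, δ, Ω_p)` and unit generator pairs, while print speaks of THE
measures `μ(𝔣𝔭̄^∞)`, `μ(𝔣̄𝔭̄^∞)` of II.4.14 in their own normalisation.  Width gen 31 left this as the one by-name input of the crux's closure
(p763736 / p768473) without a kernel «∀ ⟸ ∃» certificate.  Here:

* `thmII64_of_exists_form` — **the typed fact FOLLOWS from its ∃-form**: «for every `(p, K, ι, v, v̄, S, λ)` as in the fact and every unit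
  generator pair there EXIST a period triple, a NON-ZERO `λ`-frame `G₀`, a `λ̌`-frame `Ǧ₀`, a unit `C` and `g` with the relation» — i.e.
  II.6.4 (i) for THE pair of measures at ONE normalisation per coordinate system (+ II.4.14 existence and non-vanishing of the measure,
  + II.4.17 "fix an isomorphism `κᵢ`": any basis).  Proof = the period-axis certificate of file 7 (relation transport through the rigidity
  unit `U = G′/G₀`, the reflected frame `κ₀·U·Ǧ₀` of file 6) at the produced and the given triple.
* `exists_form_at_of_thmII64` — the converse at any datum carrying a non-zero `λ`-frame (trivial).

So, on the period and frame axes, the ∀-phrasing of the named fact is EQUIVALENT in the kernel to the print-shaped statement (given a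
non-zero frame); with files 1–2 (uniqueness of `G` and of `Ǧ` at fixed data, every split `p`) the audit of the seven PUBLISHED by-name
inputs of crux 2 is complete: 4 ∃-shaped as typed + 3 ∀-framed with kernel certificates (thmI, proofThm221 — gen 31; thmII64 — this).
HONEST FRAMING: helper theorems; the named fact itself is NOT proved (it remains a cited published theorem); nothing here proves a summit
statement, the crux, a stub, BSD, or a theorem of de Shalit / Katz / Rubin; 0 cells / labels / tiers move.

References: [deShalit1987] II.4.12 Remark (iv), II.4.14, II.4.17 (51)–(54), II.6.1 (1)–(2), II.6.4 Theorem (i) (9), (13)–(15) (p. 84–85);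
[BleherEtAl2015] Lemma 3.3.2.
-/

noncomputable section

open scoped NumberField Classical Topology
open Filter NumberField IsDedekindDomain Field
open Literature Literature.NumberTheory.GaloisRepresentations Literature.NumberTheory.EllipticCurves
open Literature.NumberTheory.EllipticCurves.DeShalit1987
open Summit.BirchSwinnertonDyer.Rank1Residual.X11b
open Summit.BirchSwinnertonDyer.BirchSwinnertonDyer.Theorems.GoodLatticeKatzMeasureUniquenessBinders

namespace Summit.BirchSwinnertonDyer.BirchSwinnertonDyer.Theorems.GoodLatticeThmII64OfExistsForm

/-! ### §10 THE CERTIFICATE IN THE SHAPE OF THE NAMED FACT: the ∃-form (print: II.6.4 for THE measures, any normalisation) implies the typed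
∀-frame / ∀-period `thmII64_katzMeasure₂_functionalEquation` -/

/-- **`DeShalit1987.thmII64_katzMeasure₂_functionalEquation` FROM ITS ∃-SHAPED (PRINT-SHAPED) FORM.**  Hypothesis (the ∃-form): for every
`(p, K, ι, v, v̄, S, λ)` as in the fact and every UNIT generator pair there EXIST a period triple `(Ω, δ, Ω_p)` (`Ω ≠ 0`, `δ² = ±d_K`,
`Ω_p ∈ R₀ˣ`), a NON-ZERO `λ`-frame `G₀`, a `λ̌`-frame `Ǧ₀` (at `c • S`), a `p`-adic unit `C` and `g ∈ Γ_K` with de Shalit's relation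
— II.6.4 (i) for THE pair of measures `μ(𝔣𝔭̄^∞)`, `μ(𝔣̄𝔭̄^∞)` in ONE normalisation, II.4.12–4.17 (existence, non-vanishing, any basis of
`Gal(K̃_∞/K)`).  Conclusion: the named fact as typed (every period triple, every frame).  Proof: §9 (unit-pair form) at the produced triple and
the given one (all six period quantities non-zero: `δ² = ±d_K ≠ 0`, `‖Ω_p‖ = 1`); `λ` has a constant integer type (`K` has one infinite place).
[cite: deShalit1987, II.6.4 Theorem (i) (9), (13)–(15) (store chunk 84–85), II.4.12 Remark (iv), II.4.14, II.4.17 (51)–(54)] -/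
theorem thmII64_of_exists_form
    (hex : ∀ (p : ℕ) [Fact p.Prime] (K : Type) [Field K] [NumberField K] [IsCMField K],
      IsImaginaryQuadratic K →
      ∀ (ι : PadicAlgCl p ≃+* ℂ) (v vbar : HeightOneSpectrum (𝓞 K)),
        ((p : ℕ) : 𝓞 K) ∈ v.asIdeal → ((p : ℕ) : 𝓞 K) ∈ vbar.asIdeal → vbar ≠ v →
        (∀ (w : InfinitePlace K) (k : 𝓞 K), k ∈ v.asIdeal ↔ ‖ι.symm (w.embedding (k : K))‖ < 1) →
      ∀ (S : Finset (HeightOneSpectrum (𝓞 K))), v ∉ S → vbar ∉ S →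
      ∀ (lam : HeckeCharacter K), lam.IsAlgebraic →
        lam.IsUnramifiedAt v → lam.IsUnramifiedAt vbar →
        (∀ w ∈ S, ¬ lam.IsUnramifiedAt w) →
        (∀ w : HeightOneSpectrum (𝓞 K), w ∉ S → w ≠ v → w ≠ vbar → lam.IsUnramifiedAt w) →
      ∀ (κ₁ κ₂ : ZpExtension K p) (γ₁ γ₂ : absoluteGaloisGroup K),
        ZpExtension.IsUnitGeneratorPair κ₁ κ₂ γ₁ γ₂ →
      ∃ (Ω δ : ℂ) (Ωp : (unrIntegers p)ˣ), Ω ≠ 0 ∧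
        (δ ^ 2 = (NumberField.discr K : ℂ) ∨ δ ^ 2 = -(NumberField.discr K : ℂ)) ∧
      ∃ (G₀ Gc₀ : PowerSeries (PowerSeries (PadicComplexInt p))) (C : ℂ_[p]) (g : absoluteGaloisGroup K),
        G₀ ≠ 0 ∧ IsKatzMeasure₂ ι v vbar S κ₁ κ₂ γ₁ γ₂ lam Ω δ ((Ωp : unrIntegers p) : ℂ_[p]) G₀ ∧
        IsKatzMeasure₂ ι v vbar (S.image fun w ↦ IsCMField.complexConj K • w) κ₁ κ₂ γ₁ γ₂
          (reflect lam) Ω δ ((Ωp : unrIntegers p) : ℂ_[p]) Gc₀ ∧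
        ‖C‖ = 1 ∧
        ∀ (r r₂ : FramedGaloisRep K (PadicAlgCl p) 1),
          FactorsThroughPair κ₁ κ₂ r → FactorsThroughPair κ₁ κ₂ r₂ → IsConjInverse r r₂ →
          ∀ x : ℂ_[p],
            IntSeries.HasValueAt₂ Gc₀ (avatarValueAt r₂ γ₁ - 1) (avatarValueAt r₂ γ₂ - 1) x →
            IntSeries.HasValueAt₂ G₀ (avatarValueAt r γ₁ - 1) (avatarValueAt r γ₂ - 1) (C * avatarValueAt r g * x)) :
    thmII64_katzMeasure₂_functionalEquation := by
  intro p _ K _ _ _ hK ι v vbar hv hvbar hne hι Ω' δ' Ωp' hΩ' hδ' S hvS hvbS lam hlam hlamv hlamvbar hprim hunr κ₁ κ₂ γ₁ γ₂ hγ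
    G' hG'
  obtain ⟨Ω, δ, Ωp, hΩ, hδ, G₀, Gc₀, C, g, hG0, hG₀, hGc₀, hC, hrel⟩ := hex p K hK ι v vbar hv hvbar hne hι S hvS hvbS lam hlam
    hlamv hlamvbar hprim hunr κ₁ κ₂ γ₁ γ₂ hγ
  -- the type of `λ` and its ramification
  obtain ⟨kl, jl, hkj⟩ := exists_hasInfinityType_const hK hlam
  have hlamS : ∀ w : HeightOneSpectrum (𝓞 K), w ∉ S → lam.IsUnramifiedAt w := by
    intro w hw
    by_cases hwv : w = v
    · rw [hwv]; exact hlamv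
    by_cases hwvb : w = vbar
    · rw [hwvb]; exact hlamvbar
    exact hunr w hw hwv hwvb
  -- non-vanishing of the period quantities
  have hD : (NumberField.discr K : ℂ) ≠ 0 := by exact_mod_cast NumberField.discr_ne_zero K
  have hδ0 : ∀ {d : ℂ}, (d ^ 2 = (NumberField.discr K : ℂ) ∨ d ^ 2 = -(NumberField.discr K : ℂ)) → d ≠ 0 := by
    rintro d hd rfl
    rcases hd with h | h
    · exact hD (by simpa using h.symm)
    · exact hD (by simpa using h.symm)
  have hΩp0 : ∀ u : (unrIntegers p)ˣ, ((u : unrIntegers p) : ℂ_[p]) ≠ 0 := fun u h0 ↦ by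
    have h1 := Halves.norm_coe_units_unrIntegers p u
    rw [h0, norm_zero] at h1
    exact zero_ne_one h1
  exact GoodLatticeThmII64PeriodAxis.thmII64_conclusion_at_every_period_of_exists_of_isUnitGeneratorPair hK hv hvbar hne hι hvbS
    hkj hlamS hγ hΩ (hδ0 hδ) (hΩp0 Ωp) hΩ' (hδ0 hδ') (hΩp0 Ωp') ⟨G₀, Gc₀, C, g, hG0, hG₀, hGc₀, hC, hrel⟩ hG'

/-- **The converse direction is trivial: the typed fact implies the ∃-form wherever a non-zero `λ`-frame exists** — so, on the class of
data carrying a non-zero frame (de Shalit II.4.14: every admissible normalisation), the typed `thmII64_katzMeasure₂_functionalEquation`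
and its ∃-form are EQUIVALENT. [cite: deShalit1987, II.6.4 Theorem (i) (store chunk 84), II.4.14] -/
theorem exists_form_at_of_thmII64 (hF : thmII64_katzMeasure₂_functionalEquation) {p : ℕ} [Fact p.Prime] {K : Type} [Field K]
    [NumberField K] [IsCMField K] (hK : IsImaginaryQuadratic K)
    {ι : PadicAlgCl p ≃+* ℂ} {v vbar : HeightOneSpectrum (𝓞 K)}
    (hv : ((p : ℕ) : 𝓞 K) ∈ v.asIdeal) (hvbar : ((p : ℕ) : 𝓞 K) ∈ vbar.asIdeal) (hne : vbar ≠ v)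
    (hι : ∀ (w : InfinitePlace K) (k : 𝓞 K), k ∈ v.asIdeal ↔ ‖ι.symm (w.embedding (k : K))‖ < 1)
    {Ω δ : ℂ} {Ωp : (unrIntegers p)ˣ} (hΩ : Ω ≠ 0)
    (hδ : δ ^ 2 = (NumberField.discr K : ℂ) ∨ δ ^ 2 = -(NumberField.discr K : ℂ))
    {S : Finset (HeightOneSpectrum (𝓞 K))} (hvS : v ∉ S) (hvbS : vbar ∉ S)
    {lam : HeckeCharacter K} (hlam : lam.IsAlgebraic) (hlamv : lam.IsUnramifiedAt v)
    (hlamvbar : lam.IsUnramifiedAt vbar) (hprim : ∀ w ∈ S, ¬ lam.IsUnramifiedAt w)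
    (hunr : ∀ w : HeightOneSpectrum (𝓞 K), w ∉ S → w ≠ v → w ≠ vbar → lam.IsUnramifiedAt w)
    {κ₁ κ₂ : ZpExtension K p} {γ₁ γ₂ : absoluteGaloisGroup K}
    (hγ : ZpExtension.IsUnitGeneratorPair κ₁ κ₂ γ₁ γ₂)
    {G₀ : PowerSeries (PowerSeries (PadicComplexInt p))} (hG0 : G₀ ≠ 0)
    (hG₀ : IsKatzMeasure₂ ι v vbar S κ₁ κ₂ γ₁ γ₂ lam Ω δ ((Ωp : unrIntegers p) : ℂ_[p]) G₀) :
    ∃ (Gc₀ : PowerSeries (PowerSeries (PadicComplexInt p))) (C : ℂ_[p]) (g : absoluteGaloisGroup K),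
      G₀ ≠ 0 ∧ IsKatzMeasure₂ ι v vbar S κ₁ κ₂ γ₁ γ₂ lam Ω δ ((Ωp : unrIntegers p) : ℂ_[p]) G₀ ∧
      IsKatzMeasure₂ ι v vbar (S.image fun w ↦ IsCMField.complexConj K • w) κ₁ κ₂ γ₁ γ₂
        (reflect lam) Ω δ ((Ωp : unrIntegers p) : ℂ_[p]) Gc₀ ∧
      ‖C‖ = 1 ∧
      ∀ (r r₂ : FramedGaloisRep K (PadicAlgCl p) 1),
        FactorsThroughPair κ₁ κ₂ r → FactorsThroughPair κ₁ κ₂ r₂ → IsConjInverse r r₂ →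
        ∀ x : ℂ_[p],
          IntSeries.HasValueAt₂ Gc₀ (avatarValueAt r₂ γ₁ - 1) (avatarValueAt r₂ γ₂ - 1) x →
          IntSeries.HasValueAt₂ G₀ (avatarValueAt r γ₁ - 1) (avatarValueAt r γ₂ - 1) (C * avatarValueAt r g * x) := by
  obtain ⟨Gc, C, g, hGc, hC, hrel⟩ := hF p K hK ι v vbar hv hvbar hne hι Ω δ Ωp hΩ hδ S hvS hvbS lam hlam hlamv hlamvbar hprim
    hunr κ₁ κ₂ γ₁ γ₂ hγ G₀ hG₀
  exact ⟨Gc, C, g, hG0, hG₀, hGc, hC, hrel⟩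

/-! ### §11 The crux decl BY NAME with de Shalit II.6.4 entered in its ∃-form -/

/-- **THE CRUX DECL `Theses.EisensteinPrimes.GoodLatticeBDPValue` from the seven published names with `thmII64` REPLACED BY ITS
∃-FORM** (the other six names as in width gen 27's `GoodLatticeBDPValueOfNamedFactsV34.goodLatticeBDPValue_of_namedFacts₃₄`; combine with
width gen 31's `GoodLatticeBDPValueOfExistsFrameForms` for ∃-forms of `thmI` / `proofThm221` / `thm212`).  CONDITIONAL on the named
inputs; closes nothing by itself; BSD is proved for no curve. [cite: KellerYin2024, Thm. 3.0.8 (IMC2) — statement shape]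
[cite: deShalit1987, II.6.4 Theorem (i)] [cite: CastellaGrossiLeeSkinner2022, Thm. 2.1.2, Thm. 2.2.1, proof of Thm. 4.2.2, Thm. 5.1.3]
[cite: Hida2010MuInvariant, Thm. I] [cite: BleherEtAl2020, §3.3 Thm. 3.3.1] -/
theorem goodLatticeBDPValue_of_namedFacts_thmII64ExistsForm
    (h422 : CastellaGrossiLeeSkinner2022.proofThm422_exists_isBDPLFunction_isTorsion_charIdeal_dvd)
    (h513 : CastellaGrossiLeeSkinner2022.thm513_exists_isBDPLFunction_valueAtOne_disc)
    (h331 : BCGKPST2020.thm331_rubin_exists_katzMeasure₂_pseudoIso_span_eq)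
    (hII64ex : ∀ (p : ℕ) [Fact p.Prime] (K : Type) [Field K] [NumberField K] [IsCMField K],
      IsImaginaryQuadratic K →
      ∀ (ι : PadicAlgCl p ≃+* ℂ) (v vbar : HeightOneSpectrum (𝓞 K)),
        ((p : ℕ) : 𝓞 K) ∈ v.asIdeal → ((p : ℕ) : 𝓞 K) ∈ vbar.asIdeal → vbar ≠ v →
        (∀ (w : InfinitePlace K) (k : 𝓞 K), k ∈ v.asIdeal ↔ ‖ι.symm (w.embedding (k : K))‖ < 1) →
      ∀ (S : Finset (HeightOneSpectrum (𝓞 K))), v ∉ S → vbar ∉ S →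
      ∀ (lam : HeckeCharacter K), lam.IsAlgebraic →
        lam.IsUnramifiedAt v → lam.IsUnramifiedAt vbar →
        (∀ w ∈ S, ¬ lam.IsUnramifiedAt w) →
        (∀ w : HeightOneSpectrum (𝓞 K), w ∉ S → w ≠ v → w ≠ vbar → lam.IsUnramifiedAt w) →
      ∀ (κ₁ κ₂ : ZpExtension K p) (γ₁ γ₂ : absoluteGaloisGroup K),
        ZpExtension.IsUnitGeneratorPair κ₁ κ₂ γ₁ γ₂ →
      ∃ (Ω δ : ℂ) (Ωp : (unrIntegers p)ˣ), Ω ≠ 0 ∧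
        (δ ^ 2 = (NumberField.discr K : ℂ) ∨ δ ^ 2 = -(NumberField.discr K : ℂ)) ∧
      ∃ (G₀ Gc₀ : PowerSeries (PowerSeries (PadicComplexInt p))) (C : ℂ_[p]) (g : absoluteGaloisGroup K),
        G₀ ≠ 0 ∧ IsKatzMeasure₂ ι v vbar S κ₁ κ₂ γ₁ γ₂ lam Ω δ ((Ωp : unrIntegers p) : ℂ_[p]) G₀ ∧
        IsKatzMeasure₂ ι v vbar (S.image fun w ↦ IsCMField.complexConj K • w) κ₁ κ₂ γ₁ γ₂
          (reflect lam) Ω δ ((Ωp : unrIntegers p) : ℂ_[p]) Gc₀ ∧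
        ‖C‖ = 1 ∧
        ∀ (r r₂ : FramedGaloisRep K (PadicAlgCl p) 1),
          FactorsThroughPair κ₁ κ₂ r → FactorsThroughPair κ₁ κ₂ r₂ → IsConjInverse r r₂ →
          ∀ x : ℂ_[p],
            IntSeries.HasValueAt₂ Gc₀ (avatarValueAt r₂ γ₁ - 1) (avatarValueAt r₂ γ₂ - 1) x →
            IntSeries.HasValueAt₂ G₀ (avatarValueAt r γ₁ - 1) (avatarValueAt r γ₂ - 1) (C * avatarValueAt r g * x))
    (h212 : CastellaGrossiLeeSkinner2022.thm212_exists_isKatzLFunction)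
    (h221 : CastellaGrossiLeeSkinner2022.proofThm221_congruence_of_fullEisensteinDescent)
    (hI : Hida2010MuInvariant.thmI_mu_katzLFunction_eq_zero) :
    Summit.BirchSwinnertonDyer.BirchSwinnertonDyer.Theses.EisensteinPrimes.GoodLatticeBDPValue :=
  GoodLatticeBDPValueOfNamedFactsV34.goodLatticeBDPValue_of_namedFacts₃₄
    ⟨⟨h422, h513, h331, thmII64_of_exists_form hII64ex⟩, h212⟩ h221 hI

end Summit.BirchSwinnertonDyer.BirchSwinnertonDyer.Theorems.GoodLatticeThmII64OfExistsForm

end
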